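import Summits.ABC.StewartYu.SatBasisReduced
import Summits.ABC.StewartYu.PadicG3SatFrame
import HarnessLib

/-!
# The lattice kit `SatKit n` holds at every rank (line `sat-odd` of crux r3 `PadicCoreOddRat`, stub `stub_satKit`)

`Summits/ABC/ABC/Theorems/YuMatveevShapeRatPadicCoreOddRatSatKit.lean` (theorems only; no named facts). Cell `abc-stewartyu`, route `YuMatveevShapeRat` (A1.L); seat p1 (lattice kit
owner, plan ASSIGN / p2 16:22:59Z (A)). `Summit.ABC.StewartYu.SatKit n` (p2, `PadicG3SatFrame`) asks, for every positive
multiplicatively independent `α : Fin n → ℚ`, for a positive independent `2`-Kummer basis `θ` with integer `U, C`, index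
`0 < N`, `θᵢ^N = ∏ αⱼ^{Uᵢⱼ}`, `αⱼ = ∏ θᵢ^{Cⱼᵢ}`, `UC = CU = N·1`, and the SIZE lines `N ≤ ∏ 2·max(1,h(αⱼ))/log 2`,
`Σᵢ|Uᵢⱼ| ≤ n·N`, `|Cⱼₖ| ≤ n!·N`, `h(θᵢ) ≤ Σⱼ max(1,h(αⱼ))`. This is `SatBasisReduced.exists_reduced_satFrame` (p3's
`SatFrameKit.exists_satFrame` re-based on the Hermite-reduced rows of `LatticeReducedRows`) weakened by `sizes_weaken`.

## References
* [Nesterenko2003] Yu. V. Nesterenko, LNM 1819 (2003) — §3.4–3.5 (the lattice `𝔑`), §4.3 Cor 4.5.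
* [Cassels1997] J. W. S. Cassels, *An Introduction to the Geometry of Numbers*, Ch. I §2.2.
-/

namespace Summit.ABC.ABC.Theorems

open Finset Summit.ABC.StewartYu

/-- **The lattice kit holds at every rank**: `∀ n, SatKit n` — the registered stub `stub_satKit` of line `sat-odd`
(crux `PadicCoreOddRat`). [cite: Nesterenko2003, §3.5 and §4.3 Cor 4.5; Cassels1997, Ch. I §2.2] -/
theorem satKit_all : ∀ n, SatKit n := by
  intro n α hα hind
  obtain ⟨θ, U, C, N, hpos, hθind, -, hkum, hNpos, hU, hC, hUC, hCU, -, hNle, -, hcol, hCle, hht, -⟩ :=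
    SatBasisReduced.exists_reduced_satFrame α hα hind
  obtain ⟨hN', hC', hh'⟩ := SatBasisReduced.sizes_weaken (θ := θ) hNle hCle hht
  refine ⟨θ, U, C, N, hpos, hθind, hkum, hNpos, hU, hC, hUC, hCU, hN', hcol, fun j k => ?_, hh'⟩
  push_cast
  exact hC' j k

/-- Pointwise form. [cite: Nesterenko2003, §3.5 and §4.3 Cor 4.5] -/
theorem satKit (n : ℕ) : SatKit n := satKit_all n

end Summit.ABC.ABC.Theorems
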